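import Literature.Dynamics.SymbolicDynamics.StrongIrreducibility
import Literature.Dynamics.SymbolicDynamics.DistortionLayer
import HarnessLib

/-!
# Gangloff–Sablik's distortion operator `d_A` and the preservation of aperiodicity (Prop. 27)

Gangloff–Sablik §5.4.2: for a set `X ⊆ A^{ℤ²}` of configurations, `d_A(X) ⊆ (Option A)^{ℤ²}`
is the set of configurations `z` whose layer of `→`/`↓` (`some`/`none`) obeys the rules of the
distortion layer (`IsDelta`, file `DistortionLayer.lean`) and whose *pseudo-projection* — the
configuration read along the curves, `P(z)_{i,k} = z (point of curve k in column i)` — lies in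
`X`. Curves are numbered upwards from the curve through the *base cell* (the lowest `→`-cell of
column `0` at height `≥ 0`); `curvePt hz i k` is the point of curve `k` in column `i`, i.e.
`succPerm ^ i (nxtPerm ^ k base)`.

* `distortion X` — the operator `d_A` ("`d_A(X) = P⁻¹(X)`").
* `some_comp_mem_distortion` — undistorted configurations: `some ∘ x ∈ d_A(X)` for `x ∈ X`
  (all cells `→`, straight curves), so `d_A(X)` is non-empty when `X` is.
* `isAperiodic_distortion` — **Prop. 27: `d_A` preserves aperiodicity**, here for the strong
  notion `IsAperiodic` (no non-zero period of any configuration) on both sides and with a direct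
  proof needing no double period: if `u` is a period of `z ∈ d_A(X)`, translation by `u` is a
  permutation of the `→`-cells commuting with "follow the curve" and "next curve"; the cell
  `succ^{u₁}(base) - u` lies in column `0`, hence is `nxt^{s}(base)` for some `s`, and then
  `curvePt (u₁ + i) k = u + curvePt i (k + s)` for all `i, k`, so that the pseudo-projection has
  the non-zero period `(u₁, -s)`. (The printed proof treats a doubly periodic `z` and codes the
  intersections of the curves with the columns modulo the period.)

That `d_A(X)` is again of finite type when `X` is (§5.4.2, "because the gap between two contiguous
curves is bounded") is proved in `DistortionSFT.lean`.

## References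

* S. Gangloff, M. Sablik, *Quantified block gluing for multidimensional subshifts of finite type:
  aperiodicity and entropy*, J. Anal. Math. 144 (2021) 21–118, §5.4.2 and Prop. 27
  (arXiv:1706.01627, pp. 14–15).
-/

namespace Literature.Dynamics.SymbolicDynamics.Distortion

open _root_.SymbolicDynamics.FullShift

variable {A : Type*} {z : ℤ × ℤ → Option A}

/-! ### Columns and rows along powers of the two permutations -/

/-- Following a curve `m` columns (to the right for `m ≥ 0`, to the left for `m < 0`) lands in
column `col + m`. [cite: GangloffSablik2021, §5.4.1 (arXiv numbering)] -/
theorem succPerm_zpow_col (hz : IsDelta z) (m : ℤ) (c : RC z) :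
    ((succPerm hz ^ m) c).1.1 = c.1.1 + m := by
  induction m using Int.induction_on generalizing c with
  | zero => simp
  | succ m ih =>
    rw [zpow_add_one, Equiv.Perm.mul_apply, ih, succPerm_apply, succFun_col]
    ring
  | pred m ih =>
    rw [zpow_sub_one, Equiv.Perm.mul_apply, ih, Equiv.Perm.inv_def, succPerm_symm_apply,
      predFun_col]
    ring

/-- Passing to other curves of the same column stays in the column.
[cite: GangloffSablik2021, §5.4.1 (arXiv numbering)] -/
theorem nxtPerm_zpow_col (hz : IsDelta z) (m : ℤ) (c : RC z) :
    ((nxtPerm hz ^ m) c).1.1 = c.1.1 := by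
  induction m using Int.induction_on generalizing c with
  | zero => simp
  | succ m ih =>
    rw [zpow_add_one, Equiv.Perm.mul_apply, ih, nxtPerm_apply, nxtFun_col]
  | pred m ih =>
    rw [zpow_sub_one, Equiv.Perm.mul_apply, ih, Equiv.Perm.inv_def, nxtPerm_symm_apply,
      prvFun_col]

/-! ### The base cell and the points of the curves -/

/-- The **base cell**: the `→`-cell `(0, 0)` if it is one, else `(0, 1)` (which then is): the
curve through it is numbered `0` (the source starts the numbering at `(0,0)` "if
`δ_{(0,0)} = →`, else `(0,1)`"). [cite: GangloffSablik2021, §5.4.1 (arXiv numbering)] -/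
def base (hz : IsDelta z) : RC z :=
  if h : z (0, 0) = none then ⟨(0, 1), by have := hz.above_ne_none h; rwa [zero_add] at this⟩
  else ⟨(0, 0), h⟩

/-- The base cell lies in column `0`. [cite: GangloffSablik2021, §5.4.1 (arXiv numbering)] -/
theorem base_col (hz : IsDelta z) : (base hz).1.1 = 0 := by
  unfold base
  split_ifs <;> rfl

/-- **The point of curve `k` in column `i`** (`φ_{δ,k}(i)` in the source): follow curve `0` from
the base cell to column `i`, then pass to the `k`-th contiguous curve above (equivalently, by
`commute_succPerm_nxtPerm`, the other way round). [cite: GangloffSablik2021, §5.4.1 (arXiv numbering)] -/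
def curvePt (hz : IsDelta z) (i k : ℤ) : RC z :=
  (succPerm hz ^ i) ((nxtPerm hz ^ k) (base hz))

/-- The point of any curve in column `i` lies in column `i`. [cite: GangloffSablik2021, §5.4.1 (arXiv numbering)] -/
theorem curvePt_col (hz : IsDelta z) (i k : ℤ) : (curvePt hz i k).1.1 = i := by
  unfold curvePt
  rw [succPerm_zpow_col, nxtPerm_zpow_col, base_col, zero_add]

/-- Moving `m` columns along the curves. [cite: GangloffSablik2021, §5.4.1 (arXiv numbering)] -/
theorem curvePt_add_left (hz : IsDelta z) (m i k : ℤ) :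
    curvePt hz (m + i) k = (succPerm hz ^ m) (curvePt hz i k) := by
  unfold curvePt
  rw [zpow_add, Equiv.Perm.mul_apply]

/-- Moving `m` curves up in a column. [cite: GangloffSablik2021, §5.4.1 (arXiv numbering)] -/
theorem curvePt_add_right (hz : IsDelta z) (i k m : ℤ) :
    curvePt hz i (k + m) = (nxtPerm hz ^ m) (curvePt hz i k) := by
  unfold curvePt
  have hc : Commute (succPerm hz ^ i) (nxtPerm hz ^ m) :=
    (commute_succPerm_nxtPerm hz).zpow_zpow i m
  rw [add_comm k m, zpow_add, Equiv.Perm.mul_apply, ← Equiv.Perm.mul_apply (succPerm hz ^ i),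
    hc.eq, Equiv.Perm.mul_apply]

/-- One column to the right along the curve. [cite: GangloffSablik2021, §5.4.1 (arXiv numbering)] -/
theorem curvePt_one_add (hz : IsDelta z) (i k : ℤ) :
    curvePt hz (1 + i) k = succFun hz (curvePt hz i k) := by
  rw [curvePt_add_left, zpow_one, succPerm_apply]

/-- One curve up. [cite: GangloffSablik2021, §5.4.1 (arXiv numbering)] -/
theorem curvePt_add_one (hz : IsDelta z) (i k : ℤ) :
    curvePt hz i (k + 1) = nxtFun hz (curvePt hz i k) := by
  rw [curvePt_add_right, zpow_one, nxtPerm_apply]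

/-- **Every `→`-cell lies on a curve**: the `→`-cell `c` of column `i` is `curvePt i k` for some
`k` (the `→`-cells of column `0` form one `nxtPerm`-orbit, `exists_nxtPerm_zpow_eq`, and
`succPerm ^ i` is a bijection onto the `→`-cells of column `i`).
[cite: GangloffSablik2021, §5.4.1 (arXiv numbering)] -/
theorem exists_curvePt_eq (hz : IsDelta z) (c : RC z) : ∃ k : ℤ, curvePt hz c.1.1 k = c := by
  have hcol : ((succPerm hz ^ (-c.1.1)) c).1.1 = (base hz).1.1 := by
    rw [succPerm_zpow_col, base_col]
    ring
  obtain ⟨k, hk⟩ := exists_nxtPerm_zpow_eq hz (base hz) ((succPerm hz ^ (-c.1.1)) c) hcol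
  refine ⟨k, ?_⟩
  unfold curvePt
  rw [hk, ← Equiv.Perm.mul_apply, ← zpow_add, add_neg_cancel, zpow_zero, Equiv.Perm.one_apply]

/-! ### The operator -/

/-- `x` is **the pseudo-projection** of `z` (`x = P(z)`): reading `z` along curve `k` at column `i`
gives `x (i, k)` (so the `→`-cells carry exactly the symbols of `x`, in curve order).
[cite: GangloffSablik2021, §5.4.2 (arXiv numbering)] -/
def IsProj (hz : IsDelta z) (x : ℤ × ℤ → A) : Prop :=
  ∀ i k : ℤ, z (curvePt hz i k).1 = some (x (i, k))

/-- **The distortion operator `d_A`**: `d_A(X)` is the set of configurations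
`z : ℤ² → Option A` whose `→`/`↓`-layer obeys the rules of `Δ` and whose pseudo-projection lies
in `X` ("`d_A(X) = P⁻¹(X)`"). [cite: GangloffSablik2021, §5.4.2 (arXiv numbering)] -/
def distortion (X : Set (ℤ × ℤ → A)) : Set (ℤ × ℤ → Option A) :=
  {z | ∃ hz : IsDelta z, ∃ x ∈ X, IsProj hz x}

/-- The pseudo-projection is determined by `z`. [cite: GangloffSablik2021, §5.4.2 (arXiv numbering)] -/
theorem IsProj.unique (hz : IsDelta z) {x x' : ℤ × ℤ → A} (h : IsProj hz x) (h' : IsProj hz x') :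
    x = x' := by
  funext ⟨i, k⟩
  exact Option.some_injective _ ((h i k).symm.trans (h' i k))

/-! ### Undistorted configurations -/

section Undistorted

variable (x : ℤ × ℤ → A)

/-- A configuration all of whose cells are `→` obeys the rules vacuously. [cite: GangloffSablik2021, §5.4.2 (arXiv numbering)] -/
theorem isDelta_some_comp : IsDelta (some ∘ x) :=
  ⟨fun _ _ h => absurd h (Option.some_ne_none _), fun _ _ h => absurd h (Option.some_ne_none _),
    fun _ _ h => absurd h (Option.some_ne_none _)⟩

/-- Without `↓`'s the curves are the rows: the point of curve `k` in column `i` is `(i, k)`.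
[cite: GangloffSablik2021, §5.4.2 (arXiv numbering)] -/
theorem curvePt_some_comp (i k : ℤ) : (curvePt (isDelta_some_comp x) i k).1 = (i, k) := by
  have hsome : ∀ c : ℤ × ℤ, (some ∘ x) c ≠ none := fun c => Option.some_ne_none _
  have hb : (base (isDelta_some_comp x)).1 = (0, 0) := by
    unfold base
    rw [dif_neg (hsome _)]
  have hN : ∀ c : RC (some ∘ x), (nxtFun (isDelta_some_comp x) c).1 = (c.1.1, c.1.2 + 1) :=
    fun c => nxtFun_val_of_ne_none _ c (hsome _)
  have hP : ∀ c : RC (some ∘ x), (prvFun (isDelta_some_comp x) c).1 = (c.1.1, c.1.2 - 1) := by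
    intro c
    unfold prvFun
    rw [dif_neg (hsome _)]
  have hS : ∀ c : RC (some ∘ x), (succFun (isDelta_some_comp x) c).1 = (c.1.1 + 1, c.1.2) :=
    fun c => succFun_val_of_ne_none _ c (hsome _)
  have hPr : ∀ c : RC (some ∘ x), (predFun (isDelta_some_comp x) c).1 = (c.1.1 - 1, c.1.2) := by
    intro c
    unfold predFun
    rw [dif_neg (hsome _)]
  -- the curves of column `0`
  have hcol0 : ∀ k : ℤ, ((nxtPerm (isDelta_some_comp x) ^ k) (base (isDelta_some_comp x))).1 =
      (0, k) := by
    intro k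
    induction k using Int.induction_on with
    | zero => simpa using hb
    | succ m ih =>
      rw [show ((m : ℤ) + 1 : ℤ) = 1 + m by ring, zpow_add, zpow_one, Equiv.Perm.mul_apply,
        nxtPerm_apply, hN, ih]
      exact Prod.ext rfl (by dsimp only; ring)
    | pred m ih =>
      rw [show (-(m : ℤ) - 1 : ℤ) = -1 + -m by ring, zpow_add, Equiv.Perm.mul_apply, zpow_neg_one,
        Equiv.Perm.inv_def, nxtPerm_symm_apply, hP, ih]
      exact Prod.ext rfl (by dsimp only; ring)
  induction i using Int.induction_on with
  | zero =>
    unfold curvePt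
    rw [zpow_zero, Equiv.Perm.one_apply, hcol0]
  | succ m ih =>
    rw [show ((m : ℤ) + 1 : ℤ) = 1 + m by ring, curvePt_add_left, zpow_one, succPerm_apply, hS, ih]
    exact Prod.ext (by dsimp only; ring) rfl
  | pred m ih =>
    rw [show (-(m : ℤ) - 1 : ℤ) = -1 + -m by ring, curvePt_add_left, zpow_neg_one,
      Equiv.Perm.inv_def, succPerm_symm_apply, hPr, ih]
    exact Prod.ext (by dsimp only; ring) rfl

/-- **Undistorted configurations belong to `d_A(X)`**: for `x ∈ X`, the configuration `some ∘ x`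
(every cell `→`, carrying `x`) is in `d_A(X)`, its pseudo-projection being `x` itself. In
particular `d_A(X)` is non-empty when `X` is. [cite: GangloffSablik2021, §5.4.2 (arXiv numbering)] -/
theorem some_comp_mem_distortion {X : Set (ℤ × ℤ → A)} {x : ℤ × ℤ → A} (hx : x ∈ X) :
    some ∘ x ∈ distortion X :=
  ⟨isDelta_some_comp x, x, hx, fun i k => by rw [curvePt_some_comp]; rfl⟩

/-- `d_A(X)` is non-empty when `X` is. [cite: GangloffSablik2021, §5.4.2 (arXiv numbering)] -/
theorem distortion_nonempty {X : Set (ℤ × ℤ → A)} (hX : X.Nonempty) : (distortion X).Nonempty :=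
  let ⟨_, hx⟩ := hX
  ⟨_, some_comp_mem_distortion hx⟩

end Undistorted

/-! ### Prop. 27: the distortion operator preserves aperiodicity -/

/-- **A period of a distorted configuration distorts periodically**: if `u` is a period of `z`
(obeying the rules of `Δ`), there is an integer `s` with
`curvePt (u₁ + i) k = u + curvePt i (k + s)` for all `i, k` — following any curve `u₁` columns
to the right is the same as translating by `u` the curve `s` curves higher. (`s` is defined by
`succ^{u₁}(base) - u = nxt^{s}(base)`, the left side being a `→`-cell of column `0`.)
[cite: GangloffSablik2021, Prop. 27 (arXiv numbering)] -/
theorem exists_curvePt_add_eq (hz : IsDelta z) {u : ℤ × ℤ} (hu : ∀ c : ℤ × ℤ, z (u + c) = z c) :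
    ∃ s : ℤ, ∀ i k : ℤ, (curvePt hz (u.1 + i) k).1 = u + (curvePt hz i (k + s)).1 := by
  set T := transPerm hu with hT
  set S := succPerm hz with hS
  set N := nxtPerm hz with hN
  have hTS : Commute T S := commute_transPerm_succPerm hz hu
  have hTN : Commute T N := commute_transPerm_nxtPerm hz hu
  have hSN : Commute S N := commute_succPerm_nxtPerm hz
  -- `T⁻¹ (S ^ u.1) base` is a `→`-cell of column `0`
  have hcol : (T.symm ((S ^ u.1) (base hz))).1.1 = (base hz).1.1 := by
    show -u.1 + ((S ^ u.1) (base hz)).1.1 = (base hz).1.1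
    rw [hS, succPerm_zpow_col]
    ring
  obtain ⟨s, hs⟩ := exists_nxtPerm_zpow_eq hz (base hz) _ hcol
  -- so `S ^ u.1 base = T (N ^ s base)`
  have hs' : (S ^ u.1) (base hz) = T ((N ^ s) (base hz)) := by
    rw [hs, Equiv.apply_symm_apply]
  refine ⟨s, fun i k => ?_⟩
  have key : curvePt hz (u.1 + i) k = T (curvePt hz i (k + s)) := by
    unfold curvePt
    rw [← hS, ← hN]
    calc (S ^ (u.1 + i)) ((N ^ k) (base hz))
        = (S ^ i) ((S ^ u.1) ((N ^ k) (base hz))) := by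
          rw [add_comm, zpow_add, Equiv.Perm.mul_apply]
      _ = (S ^ i) ((N ^ k) ((S ^ u.1) (base hz))) := by
          rw [← Equiv.Perm.mul_apply (S ^ u.1), (hSN.zpow_zpow u.1 k).eq, Equiv.Perm.mul_apply]
      _ = (S ^ i) ((N ^ k) (T ((N ^ s) (base hz)))) := by rw [hs']
      _ = (S ^ i) (T ((N ^ k) ((N ^ s) (base hz)))) := by
          rw [← Equiv.Perm.mul_apply (N ^ k), ← (hTN.zpow_right k).eq, Equiv.Perm.mul_apply]
      _ = T ((S ^ i) ((N ^ k) ((N ^ s) (base hz)))) := by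
          rw [← Equiv.Perm.mul_apply (S ^ i), ← (hTS.zpow_right i).eq, Equiv.Perm.mul_apply]
      _ = T ((S ^ i) ((N ^ (k + s)) (base hz))) := by
          rw [zpow_add, Equiv.Perm.mul_apply]
  rw [key]
  rfl

/-- **Gangloff–Sablik Prop. 27: the distortion operator preserves aperiodicity.** If no
configuration of `X` has a non-zero period, then no configuration of `d_A(X)` has one: a period
`u ≠ 0` of `z ∈ d_A(X)` would give the pseudo-projection `P(z) ∈ X` the period `(u₁, -s)` of
`exists_curvePt_add_eq`, which is non-zero (if `u₁ = 0 = s` then `curvePt 0 0 = u + curvePt 0 0`).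
[cite: GangloffSablik2021, Prop. 27 (arXiv numbering)] -/
theorem isAperiodic_distortion {X : Set (ℤ × ℤ → A)} (hX : IsAperiodic X) :
    IsAperiodic (distortion X) := by
  rintro z ⟨hz, x, hxX, hproj⟩ u hu hzu
  have hu' : ∀ c : ℤ × ℤ, z (u + c) = z c := fun c => congrFun hzu c
  obtain ⟨s, hs⟩ := exists_curvePt_add_eq hz hu'
  -- the pseudo-projection has the period `(u.1, -s)`
  have hx : ∀ i k : ℤ, x (u.1 + i, k) = x (i, k + s) := by
    intro i k
    have h1 := hproj (u.1 + i) k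
    rw [hs, hu'] at h1
    exact Option.some_injective _ (h1.symm.trans (hproj i (k + s)))
  have hper : shift ((u.1, -s) : ℤ × ℤ) x = x := by
    funext w
    obtain ⟨a, b⟩ := w
    show x ((u.1, -s) + (a, b)) = x (a, b)
    rw [Prod.mk_add_mk, hx, show -s + b + s = b by ring]
  have hne : ((u.1, -s) : ℤ × ℤ) ≠ 0 := by
    intro h0
    obtain ⟨h1, h2⟩ := Prod.ext_iff.mp h0
    dsimp only at h1 h2
    have h3 := hs 0 0
    rw [h1, neg_eq_zero.mp h2, add_zero, add_zero] at h3
    -- `c = u + c` forces `u = 0`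
    apply hu
    have := congrArg (fun c : ℤ × ℤ => c - (curvePt hz 0 0).1) h3
    simpa using this.symm
  exact hX x hxX _ hne hper

end Literature.Dynamics.SymbolicDynamics.Distortion
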